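import Literature.Combinatorics.StablePolynomials.HypergeometricRealRooted
import Literature.Probability.Distributions.PoissonBinomialRecursion
import Literature.Probability.Distributions.HypergeometricStochasticOrder
import HarnessLib

/-!
# Real-rooted polynomials with nonnegative coefficients are Bernoulli products;
# the hypergeometric law is a Poisson-binomial law

Two elementary facts and their assembly.

* §1 (**real roots + nonnegative coefficients ⇒ Bernoulli product**). A nonzero real polynomial
  `P` with nonnegative coefficients all of whose complex zeros are real factors as
  `P = P(1) · ∏_i ((1 − p_i) + p_i X)` with `p_i ∈ (0, 1]`, the number of factors being `deg P`
  (`exists_bernoulliProd_of_roots_real`). Proof: over `ℂ` the polynomial splits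
  (`IsAlgClosed.card_roots_eq_natDegree`); the roots being real, the factorisation
  `P = c · ∏ (X − ρ_i)` pulls back along `ℝ → ℂ` (`eq_C_mul_prod_X_sub_C_of_roots_real`); a
  polynomial with nonnegative coefficients is positive on `(0, ∞)` (`eval_pos_of_coeff_nonneg`), so
  `ρ_i ≤ 0`, and `X − ρ_i = (1 − ρ_i)·((1 − p_i) + p_i X)` with `p_i = 1/(1 − ρ_i)`.
  This is the equivalence «generating polynomial with only real zeros ⇔ law of a sum of
  independent Bernoulli variables» [Pitman 1997, §1, around (3)–(4); the `⇐` direction is trivial].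
* §2 (**the generating polynomial of Lange's table**). The coefficients of
  `∏_{p ∈ ps} ((1 − p) + p X)` are the Poisson-binomial probabilities `PoissonBinomial.pmf ps`
  computed by Lange's recursion (`coeff_bernoulliProd_eq_pmf`) [Lange 2010, §1.7 eq. (1.4)].
* §3 (**hypergeometric = Poisson-binomial**). For `r ≤ b + d` the hypergeometric generating
  polynomial `hyperGen b d r = Σ_k C(b,k) C(d,r−k) X^k` has only real zeros (tree:
  `im_eq_zero_of_aeval_hyperGen_eq_zero`, Vatutin–Mikhailov), nonnegative coefficients and value
  `C(b+d, r)` at `1` (Vandermonde), hence `hyperGen b d r = C(b+d,r) · ∏_{p ∈ ps} ((1 − p) + p X)`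
  for a list `ps ⊆ (0,1]` of length `≤ r` (`exists_bernoulliProd_eq_hyperGen`), and THE HYPERGEOMETRIC
  LAW IS A POISSON-BINOMIAL LAW IN TABLE FORM: with the tree's
  `hypergeomPMFReal M L m l = C(L,l) C(M−L,m−l)/C(M,m)` (`HypergeometricStochasticOrder.lean`),
  `hypergeomPMFReal (b+d) b r k = PoissonBinomial.pmf ps k` for all `k ≤ r`
  (`exists_hypergeomPMFReal_eq_pmf`) [Vatutin–Mikhailov 1983, §2; Pitman 1997, §1].
* §4 (**moments**). The parameters `p_i` are `1/(1 − ρ_i)` for the (non-explicit) roots `ρ_i`, but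
  their first two power sums are explicit: comparing means and variances of the two tables
  (tree: `PoissonBinomial.mean_pmf`, `variance_pmf`; here the factorial moments
  `Σ k C(b,k)C(d,r+1−k) = b C(b+d−1,r)`, `Σ k(k−1) C(b,k)C(d,r+2−k) = b(b−1) C(b+d−2,r)` —
  `sum_mul_choose_mul_choose`, `sum_mul_mul_choose_mul_choose`) gives `Σ p_i = r b/(b+d)` and
  `Σ p_i(1−p_i) = r b d (b+d−r)/((b+d)²(b+d−1))`, the hypergeometric mean and variance
  (`sum_eq_of_hyperGen_eq`, `sum_mul_one_sub_eq_of_hyperGen_eq`,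
  `exists_hypergeomPMFReal_eq_pmf_moments`) [Lehmann–Romano 2005, Example 3.4.1 (the law)].
* §5 (**binomial moments of all orders; the factorial-moment tail**). `Σ_j C(j,k)C(b,j)C(d,r−j) =
  C(b,k)C(b−k+d,r−k)` (`sum_choose_mul_choose_mul_choose`), hence by Markov on the `k`-th binomial
  moment the upper tail `Σ_{j ≥ k} C(b,j)C(d,r−j) ≤ C(b,k)C(b−k+d,r−k)` (`sum_Ico_choose_mul_choose_le`),
  normalised `P(≥ k of r draws marked) ≤ C(r,k)·C(b,k)/C(b+d,k) ≤ C(r,k)·(b/(b+d))^k`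
  (`sum_Ico_hypergeomPMFReal_le`, `choose_mul_pow_le`).

All PROVED, 0 sorry, no definitions, no named facts. Cell pnp-psdrank (LIT-44 §5 (c3) / LIT-45 §2:
every smoothness statement about Poisson-binomial tables — `PoissonBinomialSmoothness.lean` —
transfers verbatim to the hypergeometric components of the shell laws).

## References

* [Pitman1997] J. Pitman, *Probabilistic bounds on the coefficients of polynomials with only real
  zeros*, JCTA 77 (1997) 279–303, §1.
* [VatutinMikhailov1983] V. A. Vatutin, V. G. Mikhailov, Theory Probab. Appl. 27:4 (1983) 734–743, §2.
* [Lange2010] K. Lange, *Numerical Analysis for Statisticians*, 2nd ed. (2010), §1.7 eq. (1.4).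
* [LehmannRomano2005] E. L. Lehmann, J. P. Romano, *Testing Statistical Hypotheses*, 3rd ed. (2005),
  Example 3.4.1 (the hypergeometric law).
-/

noncomputable section

open Finset Polynomial

namespace Literature.Combinatorics.StablePolynomials

/-! ### §1 Real-rooted polynomials with nonnegative coefficients -/

/-- A nonzero polynomial with nonnegative coefficients is positive on `(0, ∞)` (so its real zeros are
`≤ 0`). [cite: Pitman1997, §1] -/
theorem eval_pos_of_coeff_nonneg {P : ℝ[X]} (hP : P ≠ 0) (h0 : ∀ n, 0 ≤ P.coeff n) {x : ℝ}
    (hx : 0 < x) : 0 < P.eval x := by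
  rw [eval_eq_sum, Polynomial.sum_def]
  refine sum_pos' (fun n _ => mul_nonneg (h0 n) (pow_nonneg hx.le n))
    ⟨P.natDegree, natDegree_mem_support_of_nonzero hP, ?_⟩
  exact mul_pos (lt_of_le_of_ne (h0 _) (Ne.symm (leadingCoeff_ne_zero.2 hP))) (pow_pos hx _)

/-- A real polynomial all of whose complex roots are real is the product of its leading coefficient
and the linear factors at the (real parts of the) complex roots: the factorisation over `ℂ` pulls
back along `ℝ → ℂ`. [cite: Pitman1997, §1] -/
theorem eq_C_mul_prod_X_sub_C_of_roots_real {P : ℝ[X]}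
    (h : ∀ z ∈ (P.map (algebraMap ℝ ℂ)).roots, z.im = 0) :
    P = C P.leadingCoeff *
      (((P.map (algebraMap ℝ ℂ)).roots.map Complex.re).map fun x => X - C x).prod := by
  apply Polynomial.map_injective (algebraMap ℝ ℂ) (algebraMap ℝ ℂ).injective
  have hc := C_leadingCoeff_mul_prod_multiset_X_sub_C
    (IsAlgClosed.card_roots_eq_natDegree (p := P.map (algebraMap ℝ ℂ)))
  rw [Polynomial.map_mul, Polynomial.map_C, Polynomial.map_multiset_prod, Multiset.map_map,
    Multiset.map_map, ← leadingCoeff_map_of_injective (algebraMap ℝ ℂ).injective P]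
  refine (hc.symm.trans ?_)
  congr 2
  refine Multiset.map_congr rfl fun z hz => ?_
  have hz' : ((z.re : ℝ) : ℂ) = z := Complex.ext (by simp) (by simp [h z hz])
  simp only [Function.comp_apply, Polynomial.map_sub, Polynomial.map_X, Polynomial.map_C]
  rw [show (algebraMap ℝ ℂ) z.re = ((z.re : ℝ) : ℂ) from rfl, hz']

/-- The real parts of the complex roots of a nonzero real polynomial with nonnegative coefficients
and only real roots are `≤ 0`. [cite: Pitman1997, §1] -/
theorem re_nonpos_of_mem_roots {P : ℝ[X]} (hP : P ≠ 0) (h0 : ∀ n, 0 ≤ P.coeff n) {z : ℂ}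
    (hz : z ∈ (P.map (algebraMap ℝ ℂ)).roots) (hreal : z.im = 0) : z.re ≤ 0 := by
  by_contra hpos
  rw [not_le] at hpos
  have hroot := (mem_roots'.1 hz).2
  rw [IsRoot.def, eval_map, ← aeval_def] at hroot
  have hz' : z = algebraMap ℝ ℂ z.re := Complex.ext (by simp) (by simp [hreal])
  rw [hz', aeval_algebraMap_apply_eq_algebraMap_eval] at hroot
  have h1 : P.eval z.re = 0 := by simpa using hroot
  exact (eval_pos_of_coeff_nonneg hP h0 hpos).ne' h1

/-- **Real roots and nonnegative coefficients ⇒ Bernoulli product.** A nonzero real polynomial with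
nonnegative coefficients all of whose complex roots are real is `P(1) · ∏_i ((1 − p_i) + p_i X)` with
all `p_i ∈ (0, 1]`, the number of factors being `deg P` — i.e. `P/P(1)` is the probability
generating polynomial of a sum of `deg P` independent Bernoulli variables.
[cite: Pitman1997, §1] -/
theorem exists_bernoulliProd_of_roots_real {P : ℝ[X]} (hP : P ≠ 0) (h0 : ∀ n, 0 ≤ P.coeff n)
    (hreal : ∀ z ∈ (P.map (algebraMap ℝ ℂ)).roots, z.im = 0) :
    ∃ ps : List ℝ, (∀ p ∈ ps, 0 < p ∧ p ≤ 1) ∧ ps.length = P.natDegree ∧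
      P = C (P.eval 1) * (ps.map fun p => C (1 - p) + C p * X).prod := by
  -- the multiset of (real parts of the) roots, all `≤ 0`, of cardinality `deg P`
  have hSle : ∀ x ∈ (P.map (algebraMap ℝ ℂ)).roots.map Complex.re, x ≤ 0 := by
    intro x hx
    rw [Multiset.mem_map] at hx
    obtain ⟨z, hz, rfl⟩ := hx
    exact re_nonpos_of_mem_roots hP h0 hz (hreal z hz)
  have hfac : P = C P.leadingCoeff *
      (((P.map (algebraMap ℝ ℂ)).roots.map Complex.re).map fun x => X - C x).prod :=
    eq_C_mul_prod_X_sub_C_of_roots_real hreal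
  have hcard : ((P.map (algebraMap ℝ ℂ)).roots.map Complex.re).card = P.natDegree := by
    rw [Multiset.card_map, IsAlgClosed.card_roots_eq_natDegree,
      natDegree_map_eq_of_injective (algebraMap ℝ ℂ).injective]
  generalize (P.map (algebraMap ℝ ℂ)).roots.map Complex.re = S at hSle hfac hcard
  -- the Bernoulli parameters `p = 1/(1 - x)`
  refine ⟨(S.map fun x => 1 / (1 - x)).toList, ?_, ?_, ?_⟩
  · intro p hp
    rw [Multiset.mem_toList, Multiset.mem_map] at hp
    obtain ⟨x, hx, rfl⟩ := hp
    have hx0 := hSle x hx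
    refine ⟨div_pos one_pos (by linarith), ?_⟩
    rw [div_le_one (by linarith)]
    linarith
  · rw [Multiset.length_toList, Multiset.card_map, hcard]
  · -- `X - x = (1 - x) · ((1 - p) + p X)` factor by factor
    have hprod : (S.map fun x => X - C x).prod =
        C (S.map fun x => 1 - x).prod *
          (((S.map fun x => 1 / (1 - x)).toList).map fun p => C (1 - p) + C p * X).prod := by
      rw [← Multiset.prod_coe, ← Multiset.map_coe, Multiset.coe_toList, Multiset.map_map,
        map_multiset_prod C, Multiset.map_map, ← Multiset.prod_map_mul]
      refine congrArg _ (Multiset.map_congr rfl fun x hx => ?_)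
      have hx1 : (1 : ℝ) - x ≠ 0 := by linarith [hSle x hx]
      simp only [Function.comp_apply]
      have h1 : C (1 - x) * C (1 / (1 - x)) = (1 : ℝ[X]) := by
        rw [← C_mul, ← C_1]; congr 1; field_simp
      have h2 : C (1 - x) * C (1 - 1 / (1 - x)) = - C x := by
        rw [← C_mul, ← C_neg]; congr 1; field_simp; ring
      linear_combination (-(X : ℝ[X])) * h1 - h2
    have hP1 : P.eval 1 = P.leadingCoeff * (S.map fun x => 1 - x).prod := by
      conv_lhs => rw [hfac, hprod]
      rw [eval_mul, eval_mul, eval_C, eval_C, eval_list_prod, List.map_map]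
      rw [List.prod_eq_one (fun y hy => by
        rw [List.mem_map] at hy
        obtain ⟨p, _, rfl⟩ := hy
        simp), mul_one]
    rw [hP1, C_mul, mul_assoc, ← hprod, ← hfac]

/-! ### §2 The generating polynomial of Lange's table -/

/-- **The coefficients of `∏_{p ∈ ps} ((1 − p) + p X)` are the Poisson-binomial probabilities**
computed by Lange's recursion. [cite: Lange2010, §1.7 eq. (1.4)] -/
theorem coeff_bernoulliProd_eq_pmf : ∀ (ps : List ℝ) (k : ℕ),
    ((ps.map fun p => C (1 - p) + C p * X).prod).coeff k =
      Literature.Probability.Distributions.PoissonBinomial.pmf ps k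
  | [], 0 => by simp
  | [], k + 1 => by simp [coeff_one]
  | p :: ps, 0 => by
    rw [List.map_cons, List.prod_cons, add_mul, coeff_add, coeff_C_mul, mul_assoc, coeff_C_mul,
      coeff_X_mul_zero, mul_zero, add_zero, coeff_bernoulliProd_eq_pmf ps 0,
      Literature.Probability.Distributions.PoissonBinomial.pmf_cons_zero]
  | p :: ps, k + 1 => by
    rw [List.map_cons, List.prod_cons, add_mul, coeff_add, coeff_C_mul, mul_assoc, coeff_C_mul,
      coeff_X_mul, coeff_bernoulliProd_eq_pmf ps k, coeff_bernoulliProd_eq_pmf ps (k + 1),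
      Literature.Probability.Distributions.PoissonBinomial.pmf_cons_succ]
    ring

/-- The generating polynomial of Lange's table has value `1` at `1` (total mass one).
[cite: Lange2010, §1.7 eq. (1.4)] -/
theorem eval_one_bernoulliProd (ps : List ℝ) :
    ((ps.map fun p => C (1 - p) + C p * X).prod).eval 1 = 1 := by
  rw [eval_list_prod, List.map_map]
  exact List.prod_eq_one fun y hy => by
    rw [List.mem_map] at hy
    obtain ⟨p, _, rfl⟩ := hy
    simp

/-- The generating polynomial of Lange's table has degree at most the number of parameters.
[cite: Lange2010, §1.7 eq. (1.4)] -/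
theorem natDegree_bernoulliProd_le (ps : List ℝ) :
    ((ps.map fun p => C (1 - p) + C p * X).prod).natDegree ≤ ps.length := by
  induction ps with
  | nil => simp
  | cons p ps ih =>
    rw [List.map_cons, List.prod_cons, List.length_cons]
    refine (natDegree_mul_le).trans ?_
    have h1 : (C (1 - p) + C p * X).natDegree ≤ 1 := by
      refine (natDegree_add_le _ _).trans (max_le ?_ ?_)
      · simp
      · exact (natDegree_C_mul_le _ _).trans (by simp)
    omega

/-! ### §3 The hypergeometric law is a Poisson-binomial law -/

/-- The coefficients of the hypergeometric generating polynomial. [cite: VatutinMikhailov1983, §2] -/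
theorem coeff_hyperGen (b d r k : ℕ) :
    (hyperGen b d r).coeff k = if k ≤ r then ((b.choose k * d.choose (r - k) : ℕ) : ℝ) else 0 := by
  rw [hyperGen, finsetSum_coeff]
  simp only [coeff_C_mul, coeff_X_pow, mul_ite, mul_one, mul_zero]
  rw [sum_ite_eq (range (r + 1)) k]
  simp [mem_range]

/-- The hypergeometric generating polynomial has nonnegative coefficients.
[cite: VatutinMikhailov1983, §2] -/
theorem coeff_hyperGen_nonneg (b d r k : ℕ) : 0 ≤ (hyperGen b d r).coeff k := by
  rw [coeff_hyperGen]
  split_ifs <;> positivity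

/-- The hypergeometric generating polynomial has degree at most `r`. [cite: VatutinMikhailov1983, §2] -/
theorem natDegree_hyperGen_le (b d r : ℕ) : (hyperGen b d r).natDegree ≤ r := by
  rw [natDegree_le_iff_coeff_eq_zero]
  intro k hk
  rw [coeff_hyperGen, if_neg (by omega)]

/-- **Vandermonde**: the hypergeometric generating polynomial takes the value `C(b+d, r)` at `1`,
`Σ_k C(b,k) C(d,r−k) = C(b+d,r)` — the hypergeometric weights sum to one.
[cite: LehmannRomano2005, Example 3.4.1] -/
theorem eval_one_hyperGen (b d r : ℕ) : (hyperGen b d r).eval 1 = ((b + d).choose r : ℝ) := by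
  rw [hyperGen, eval_finsetSum]
  simp only [eval_mul, eval_C, eval_pow, eval_X, one_pow, mul_one]
  rw [Nat.add_choose_eq, Finset.Nat.sum_antidiagonal_eq_sum_range_succ (fun i j => b.choose i * d.choose j) r]
  push_cast
  rfl

/-- The hypergeometric generating polynomial is nonzero for `r ≤ b + d`. [cite: VatutinMikhailov1983, §2] -/
theorem hyperGen_ne_zero {b d r : ℕ} (hr : r ≤ b + d) : hyperGen b d r ≠ 0 := by
  intro h
  have h1 := eval_one_hyperGen b d r
  rw [h, eval_zero] at h1
  have h2 : 0 < ((b + d).choose r : ℝ) := by exact_mod_cast Nat.choose_pos hr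
  exact h2.ne h1

/-- **The hypergeometric generating polynomial is a Bernoulli product**: for `r ≤ b + d` there are
`p_1, …, p_N ∈ (0, 1]` (`N = deg ≤ r`) with `Σ_k C(b,k) C(d,r−k) X^k = C(b+d,r) · ∏_i ((1 − p_i) + p_i X)`.
[cite: VatutinMikhailov1983, §2] [cite: Pitman1997, §1] -/
theorem exists_bernoulliProd_eq_hyperGen {b d r : ℕ} (hr : r ≤ b + d) :
    ∃ ps : List ℝ, (∀ p ∈ ps, 0 < p ∧ p ≤ 1) ∧ ps.length ≤ r ∧
      hyperGen b d r = C (((b + d).choose r : ℕ) : ℝ) * (ps.map fun p => C (1 - p) + C p * X).prod := by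
  obtain ⟨ps, hps, hlen, hfac⟩ := exists_bernoulliProd_of_roots_real (hyperGen_ne_zero hr)
    (coeff_hyperGen_nonneg b d r) (fun z hz => mem_roots_hyperGen_im_eq_zero hr hz)
  refine ⟨ps, hps, hlen ▸ natDegree_hyperGen_le b d r, ?_⟩
  rw [← eval_one_hyperGen]
  exact hfac

/-- **The hypergeometric law is a Poisson-binomial law** (table form): for `r ≤ b + d` there are
`p_1, …, p_N ∈ (0, 1]`, `N ≤ r`, such that the hypergeometric probabilities
`C(b,k) C(d,r−k) / C(b+d,r)` (`k ≤ r`; the number of marked items in a uniform `r`-subset of `b`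
marked and `d` unmarked items — the tree's `hypergeomPMFReal (b+d) b r k`) are the Poisson-binomial
probabilities `PoissonBinomial.pmf ps k` of Lange's table, i.e. the law of a sum of `N` independent
Bernoulli(`p_i`) variables. [cite: VatutinMikhailov1983, §2] [cite: Pitman1997, §1] -/
theorem exists_hypergeomPMFReal_eq_pmf {b d r : ℕ} (hr : r ≤ b + d) :
    ∃ ps : List ℝ, (∀ p ∈ ps, 0 < p ∧ p ≤ 1) ∧ ps.length ≤ r ∧
      ∀ k, k ≤ r → Literature.Probability.Distributions.hypergeomPMFReal (b + d) b r k =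
        Literature.Probability.Distributions.PoissonBinomial.pmf ps k := by
  obtain ⟨ps, hps, hlen, hfac⟩ := exists_bernoulliProd_eq_hyperGen hr
  refine ⟨ps, hps, hlen, fun k hk => ?_⟩
  have hch : (0 : ℝ) < ((b + d).choose r : ℕ) := by exact_mod_cast Nat.choose_pos hr
  have hk' := congrArg (fun Q : ℝ[X] => Q.coeff k) hfac
  simp only [coeff_C_mul, coeff_hyperGen, if_pos hk, coeff_bernoulliProd_eq_pmf] at hk'
  push_cast at hk'
  rw [Literature.Probability.Distributions.hypergeomPMFReal, Nat.add_sub_cancel_left,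
    div_eq_iff hch.ne', hk', mul_comm]

/-- Beyond `r` both tables vanish: `PoissonBinomial.pmf ps k = 0` for `k > ps.length` (tree:
`pmf_eq_zero_of_length_lt`), in particular for `k > r` when `ps.length ≤ r`.
[cite: Lange2010, §1.7 eq. (1.4)] -/
theorem pmf_eq_zero_of_lt {ps : List ℝ} {r k : ℕ} (hlen : ps.length ≤ r) (hk : r < k) :
    Literature.Probability.Distributions.PoissonBinomial.pmf ps k = 0 :=
  Literature.Probability.Distributions.PoissonBinomial.pmf_eq_zero_of_length_lt ps k (by omega)

/-! ### §4 Moments: the Bernoulli parameters of the hypergeometric law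

The parameters `p_i` of §3 are not explicit (they are `1/(1 − ρ_i)` for the roots `ρ_i` of the
hypergeometric generating polynomial), but their power sums are: comparing the mean and the variance
of the two tables gives `Σ_i p_i = r·b/(b+d)` (the hypergeometric mean) and
`Σ_i p_i(1 − p_i) = r·b·d·(b+d−r)/((b+d)²(b+d−1))` (the hypergeometric variance) — the quantity `V`
entering the smoothness bounds of `PoissonBinomialSmoothness.lean`. -/

/-- `(j+1)·C(b, j+1) = b·C(b−1, j)` (all `b`, over `ℝ`). [cite: LehmannRomano2005, Example 3.4.1] -/
private theorem succ_mul_choose_succ (b j : ℕ) :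
    ((j + 1 : ℕ) : ℝ) * (b.choose (j + 1) : ℕ) = (b : ℝ) * ((b - 1).choose j : ℕ) := by
  rcases b with _ | b
  · simp
  · have h : (j + 1) * (b + 1).choose (j + 1) = (b + 1) * b.choose j := by
      rw [mul_comm]; exact (Nat.add_one_mul_choose_eq b j).symm
    rw [Nat.add_sub_cancel]
    exact_mod_cast h

/-- **First factorial moment of the hypergeometric weights**:
`Σ_{k ≤ r+1} k·C(b,k)·C(d,r+1−k) = b·C(b−1+d, r)`. [cite: LehmannRomano2005, Example 3.4.1] -/
theorem sum_mul_choose_mul_choose (b d r : ℕ) :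
    ∑ k ∈ range (r + 2), (k : ℝ) * ((b.choose k * d.choose (r + 1 - k) : ℕ) : ℝ) =
      (b : ℝ) * (((b - 1) + d).choose r : ℕ) := by
  rw [sum_range_succ']
  simp only [Nat.cast_zero, zero_mul, add_zero]
  have key : ∀ j ∈ range (r + 1),
      ((j + 1 : ℕ) : ℝ) * ((b.choose (j + 1) * d.choose (r + 1 - (j + 1)) : ℕ) : ℝ) =
        (b : ℝ) * (((b - 1).choose j * d.choose (r - j) : ℕ) : ℝ) := by
    intro j _
    rw [Nat.add_sub_add_right, Nat.cast_mul, Nat.cast_mul, ← mul_assoc, succ_mul_choose_succ,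
      mul_assoc]
  rw [sum_congr rfl key, ← mul_sum, Nat.add_choose_eq,
    Finset.Nat.sum_antidiagonal_eq_sum_range_succ (fun i j => (b - 1).choose i * d.choose j) r]
  push_cast
  rfl

/-- **Second factorial moment of the hypergeometric weights**:
`Σ_{k ≤ r+2} k(k−1)·C(b,k)·C(d,r+2−k) = b(b−1)·C(b−2+d, r)`. [cite: LehmannRomano2005, Example 3.4.1] -/
theorem sum_mul_mul_choose_mul_choose (b d r : ℕ) :
    ∑ k ∈ range (r + 3), (k : ℝ) * ((k : ℝ) - 1) * ((b.choose k * d.choose (r + 2 - k) : ℕ) : ℝ) =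
      (b : ℝ) * (((b - 1 : ℕ) : ℝ)) * (((b - 2) + d).choose r : ℕ) := by
  rw [sum_range_succ', sum_range_succ']
  simp only [Nat.cast_zero, zero_mul, add_zero, Nat.cast_succ, zero_add, sub_self,
    mul_zero]
  have key : ∀ j ∈ range (r + 1),
      ((j : ℝ) + 1 + 1) * ((j : ℝ) + 1 + 1 - 1) *
          ((b.choose (j + 1 + 1) * d.choose (r + 2 - (j + 1 + 1)) : ℕ) : ℝ) =
        (b : ℝ) * ((b - 1 : ℕ) : ℝ) * (((b - 2).choose j * d.choose (r - j) : ℕ) : ℝ) := by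
    intro j _
    have h1 := succ_mul_choose_succ b (j + 1)
    have h2 := succ_mul_choose_succ (b - 1) j
    rw [Nat.sub_sub] at h2
    rw [show r + 2 - (j + 1 + 1) = r - j by omega, Nat.cast_mul, Nat.cast_mul]
    push_cast at h1 h2 ⊢
    calc ((j : ℝ) + 1 + 1) * ((j : ℝ) + 1 + 1 - 1) * (((b.choose (j + 1 + 1) : ℕ) : ℝ) * ((d.choose (r - j) : ℕ) : ℝ))
        = (((j : ℝ) + 1 + 1) * ((b.choose (j + 1 + 1) : ℕ) : ℝ)) *
            (((j : ℝ) + 1) * ((d.choose (r - j) : ℕ) : ℝ)) := by ring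
      _ = ((b : ℝ) * (((b - 1).choose (j + 1) : ℕ) : ℝ)) * (((j : ℝ) + 1) * ((d.choose (r - j) : ℕ) : ℝ)) := by
          rw [h1]
      _ = (b : ℝ) * ((((j : ℝ) + 1) * (((b - 1).choose (j + 1) : ℕ) : ℝ)) * ((d.choose (r - j) : ℕ) : ℝ)) := by
          ring
      _ = (b : ℝ) * ((((b - 1 : ℕ) : ℝ) * (((b - 2).choose j : ℕ) : ℝ)) * ((d.choose (r - j) : ℕ) : ℝ)) := by
          rw [h2]
      _ = (b : ℝ) * ((b - 1 : ℕ) : ℝ) * ((((b - 2).choose j : ℕ) : ℝ) * ((d.choose (r - j) : ℕ) : ℝ)) := by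
          ring
  rw [sum_congr rfl key, ← mul_sum, Nat.add_choose_eq,
    Finset.Nat.sum_antidiagonal_eq_sum_range_succ (fun i j => (b - 2).choose i * d.choose j) r]
  push_cast
  rfl

/-- `b·C(b−1+d, r) = (r+1)·b/(b+d) · C(b+d, r+1)` — the first factorial moment over the
normalisation. [cite: LehmannRomano2005, Example 3.4.1] -/
private theorem first_ratio (b d r : ℕ) :
    (b : ℝ) * (((b - 1) + d).choose r : ℕ) =
      ((r : ℝ) + 1) * b / ((b : ℝ) + d) * ((b + d).choose (r + 1) : ℕ) := by
  rcases b with _ | b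
  · simp
  · have h := Nat.add_one_mul_choose_eq (b + d) r
    -- `(b+d+1)·C(b+d, r) = C(b+d+1, r+1)·(r+1)`
    have h' : ((b : ℝ) + d + 1) * ((b + d).choose r : ℕ) =
        (((b + d + 1).choose (r + 1) : ℕ) : ℝ) * ((r : ℝ) + 1) := by exact_mod_cast h
    rw [Nat.add_sub_cancel, Nat.add_right_comm b 1 d]
    have hM : ((b : ℝ) + 1 + d) ≠ 0 := by positivity
    push_cast
    rw [div_mul_eq_mul_div, eq_div_iff hM]
    linear_combination ((b : ℝ) + 1) * h'

/-- `b(b−1)·C(b−2+d, r) = (r+2)(r+1)·b(b−1)/((b+d)(b+d−1)) · C(b+d, r+2)` — the second factorial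
moment over the normalisation. [cite: LehmannRomano2005, Example 3.4.1] -/
private theorem second_ratio (b d r : ℕ) :
    (b : ℝ) * ((b - 1 : ℕ) : ℝ) * (((b - 2) + d).choose r : ℕ) =
      ((r : ℝ) + 2) * ((r : ℝ) + 1) * (b * ((b : ℝ) - 1)) / (((b : ℝ) + d) * ((b : ℝ) + d - 1)) *
        ((b + d).choose (r + 2) : ℕ) := by
  rcases Nat.lt_or_ge b 2 with hb | hb
  · interval_cases b <;> simp
  · obtain ⟨b, rfl⟩ : ∃ b', b = b' + 2 := ⟨b - 2, by omega⟩
    have h1 := Nat.add_one_mul_choose_eq (b + d) r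
    have h2 := Nat.add_one_mul_choose_eq (b + d + 1) (r + 1)
    have h1' : ((b : ℝ) + d + 1) * ((b + d).choose r : ℕ) =
        (((b + d + 1).choose (r + 1) : ℕ) : ℝ) * ((r : ℝ) + 1) := by exact_mod_cast h1
    have h2' : ((b : ℝ) + d + 1 + 1) * ((b + d + 1).choose (r + 1) : ℕ) =
        (((b + d + 1 + 1).choose (r + 1 + 1) : ℕ) : ℝ) * ((r : ℝ) + 1 + 1) := by exact_mod_cast h2
    rw [show b + 2 - 1 = b + 1 by omega, show b + 2 - 2 = b by omega,
      show b + 2 + d = b + d + 1 + 1 by omega, show r + 2 = r + 1 + 1 by omega]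
    have hM : (((b + d + 1 + 1 : ℕ) : ℝ)) * (((b + d + 1 + 1 : ℕ) : ℝ) - 1) ≠ 0 := by
      push_cast
      exact mul_ne_zero (by positivity) (by
        rw [show (b : ℝ) + d + 1 + 1 - 1 = (b : ℝ) + d + 1 by ring]; positivity)
    push_cast at hM ⊢
    rw [show (b : ℝ) + 2 + d = (b : ℝ) + d + 1 + 1 by ring, div_mul_eq_mul_div, eq_div_iff hM]
    linear_combination ((b : ℝ) + 2) * ((b : ℝ) + 1) *
      (((b : ℝ) + d + 1 + 1) * h1' + ((r : ℝ) + 1) * h2')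

/-- For a Bernoulli-product representation of the hypergeometric generating polynomial, Lange's table
is the hypergeometric table: `pmf ps k = [k ≤ r]·C(b,k)C(d,r−k)/C(b+d,r)`.
[cite: VatutinMikhailov1983, §2] -/
theorem pmf_eq_of_hyperGen_eq {b d r : ℕ} {ps : List ℝ} (hr : r ≤ b + d)
    (hfac : hyperGen b d r =
      C (((b + d).choose r : ℕ) : ℝ) * (ps.map fun p => C (1 - p) + C p * X).prod) (k : ℕ) :
    Literature.Probability.Distributions.PoissonBinomial.pmf ps k =
      (if k ≤ r then ((b.choose k * d.choose (r - k) : ℕ) : ℝ) else 0) / ((b + d).choose r : ℕ) := by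
  have hch : (0 : ℝ) < ((b + d).choose r : ℕ) := by exact_mod_cast Nat.choose_pos hr
  have hk := congrArg (fun Q : ℝ[X] => Q.coeff k) hfac
  simp only [coeff_C_mul, coeff_hyperGen, coeff_bernoulliProd_eq_pmf] at hk
  rw [eq_div_iff hch.ne', mul_comm, ← hk]

/-- **The Bernoulli parameters of the hypergeometric law sum to its mean**: if
`hyperGen b d r = C(b+d,r) · ∏_{p ∈ ps} ((1 − p) + p X)` with `|ps| ≤ r ≤ b + d`, then
`Σ_{p ∈ ps} p = r·b/(b+d)`. [cite: LehmannRomano2005, Example 3.4.1] [cite: VatutinMikhailov1983, §2] -/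
theorem sum_eq_of_hyperGen_eq {b d r : ℕ} {ps : List ℝ} (hr : r ≤ b + d) (hlen : ps.length ≤ r)
    (hfac : hyperGen b d r =
      C (((b + d).choose r : ℕ) : ℝ) * (ps.map fun p => C (1 - p) + C p * X).prod) :
    ps.sum = (r : ℝ) * b / ((b : ℝ) + d) := by
  rw [← Literature.Probability.Distributions.PoissonBinomial.mean_pmf ps,
    sum_subset (range_subset_range.2 (by omega : ps.length + 1 ≤ r + 1)) (fun i _ hi => by
      rw [Literature.Probability.Distributions.PoissonBinomial.pmf_eq_zero_of_length_lt ps i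
        (by rw [mem_range] at hi; omega), mul_zero])]
  simp_rw [pmf_eq_of_hyperGen_eq hr hfac]
  rw [sum_congr rfl fun k hk => by rw [if_pos (Nat.lt_succ_iff.1 (mem_range.1 hk))]]
  simp_rw [← mul_div_assoc]
  rw [← sum_div]
  rcases r with _ | r
  · simp
  · have h := sum_mul_choose_mul_choose b d r
    simp only [show r + 2 = r + 1 + 1 from rfl] at h
    rw [h, first_ratio]
    have hch : (0 : ℝ) < ((b + d).choose (r + 1) : ℕ) := by exact_mod_cast Nat.choose_pos hr
    rw [mul_div_assoc, div_self hch.ne', mul_one]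
    push_cast
    ring

/-- **The Bernoulli parameters of the hypergeometric law have `Σ p(1−p)` equal to its variance**: if
`hyperGen b d r = C(b+d,r) · ∏_{p ∈ ps} ((1 − p) + p X)` with `|ps| ≤ r ≤ b + d`, then
`Σ_{p ∈ ps} p(1 − p) = r·b·d·(b+d−r)/((b+d)²(b+d−1))` (for `b + d ≤ 1` both sides vanish).
[cite: LehmannRomano2005, Example 3.4.1] [cite: VatutinMikhailov1983, §2] -/
theorem sum_mul_one_sub_eq_of_hyperGen_eq {b d r : ℕ} {ps : List ℝ} (hr : r ≤ b + d)
    (hlen : ps.length ≤ r)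
    (hfac : hyperGen b d r =
      C (((b + d).choose r : ℕ) : ℝ) * (ps.map fun p => C (1 - p) + C p * X).prod) :
    (ps.map fun p => p * (1 - p)).sum =
      (r : ℝ) * b * d * ((b : ℝ) + d - r) / (((b : ℝ) + d) ^ 2 * ((b : ℝ) + d - 1)) := by
  have hmean := sum_eq_of_hyperGen_eq hr hlen hfac
  have hext : ∀ w : ℕ → ℝ,
      ∑ i ∈ range (ps.length + 1), w i * Literature.Probability.Distributions.PoissonBinomial.pmf ps i =
        ∑ i ∈ range (r + 1), w i * Literature.Probability.Distributions.PoissonBinomial.pmf ps i :=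
    fun w => sum_subset (range_subset_range.2 (by omega : ps.length + 1 ≤ r + 1)) (fun i _ hi => by
      rw [Literature.Probability.Distributions.PoissonBinomial.pmf_eq_zero_of_length_lt ps i
        (by rw [mem_range] at hi; omega), mul_zero])
  -- the mean, in table form
  have hm : ∑ k ∈ range (r + 1), (k : ℝ) *
      ((if k ≤ r then ((b.choose k * d.choose (r - k) : ℕ) : ℝ) else 0) / ((b + d).choose r : ℕ)) =
        (r : ℝ) * b / ((b : ℝ) + d) := by
    rw [← hmean, ← Literature.Probability.Distributions.PoissonBinomial.mean_pmf ps, hext]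
    simp_rw [pmf_eq_of_hyperGen_eq hr hfac]
  rw [← Literature.Probability.Distributions.PoissonBinomial.variance_pmf ps,
    Literature.Probability.Distributions.PoissonBinomial.mean_pmf ps, hmean,
    hext (fun i => (i : ℝ) ^ 2)]
  simp_rw [pmf_eq_of_hyperGen_eq hr hfac]
  -- second moment = second factorial moment + mean
  have hsplit : ∀ k ∈ range (r + 1),
      (k : ℝ) ^ 2 * ((if k ≤ r then ((b.choose k * d.choose (r - k) : ℕ) : ℝ) else 0) /
          ((b + d).choose r : ℕ)) =
        ((k : ℝ) * ((k : ℝ) - 1) * (if k ≤ r then ((b.choose k * d.choose (r - k) : ℕ) : ℝ) else 0)) /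
            ((b + d).choose r : ℕ) +
          (k : ℝ) * ((if k ≤ r then ((b.choose k * d.choose (r - k) : ℕ) : ℝ) else 0) /
            ((b + d).choose r : ℕ)) := by
    intro k _
    ring
  rw [sum_congr rfl hsplit, sum_add_distrib, hm, ← sum_div,
    sum_congr rfl fun k hk => by rw [if_pos (Nat.lt_succ_iff.1 (mem_range.1 hk))]]
  rcases r with _ | _ | r
  · simp
  · -- r = 1: the factorial-moment sum vanishes
    simp only [sum_range_succ, sum_range_zero, Nat.cast_zero, Nat.cast_one, zero_mul, sub_self,
      mul_zero, zero_add, zero_div, one_mul]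
    rcases Nat.lt_or_ge (b + d) 2 with hM | hM
    · -- b + d = 1: both sides vanish
      have hb : b = 0 ∨ b = 1 := by omega
      rcases hb with rfl | rfl
      · simp
      · obtain rfl : d = 0 := by omega
        norm_num
    · have hM' : (2 : ℝ) ≤ (b : ℝ) + d := by exact_mod_cast hM
      have h1 : ((b : ℝ) + d) ≠ 0 := by linarith
      have h2 : ((b : ℝ) + d - 1) ≠ 0 := by linarith
      field_simp
      ring
  · -- r + 2
    have h := sum_mul_mul_choose_mul_choose b d r
    simp only [show r + 3 = r + 1 + 1 + 1 from rfl, show r + 2 = r + 1 + 1 from rfl] at h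
    rw [h, second_ratio]
    have hM : (((r + 1 + 1 : ℕ) : ℝ)) ≤ (b : ℝ) + d := by exact_mod_cast hr
    push_cast at hM
    have h1 : ((b : ℝ) + d) ≠ 0 := by linarith
    have h2 : ((b : ℝ) + d - 1) ≠ 0 := by linarith
    have hch : (((b + d).choose (r + 1 + 1) : ℕ) : ℝ) ≠ 0 := by
      have : 0 < (b + d).choose (r + 1 + 1) := Nat.choose_pos hr
      exact_mod_cast this.ne'
    rw [mul_div_assoc, div_self hch, mul_one]
    field_simp
    push_cast
    ring

/-- **The hypergeometric law is a Poisson-binomial law, with moments**: for `r ≤ b + d` there are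
`p_1, …, p_N ∈ (0,1]`, `N ≤ r`, with `hypergeomPMFReal (b+d) b r k = PoissonBinomial.pmf ps k`
(`k ≤ r`), `Σ p_i = r·b/(b+d)` and `Σ p_i(1 − p_i) = r·b·d·(b+d−r)/((b+d)²(b+d−1))`.
[cite: VatutinMikhailov1983, §2] [cite: Pitman1997, §1] [cite: LehmannRomano2005, Example 3.4.1] -/
theorem exists_hypergeomPMFReal_eq_pmf_moments {b d r : ℕ} (hr : r ≤ b + d) :
    ∃ ps : List ℝ, (∀ p ∈ ps, 0 < p ∧ p ≤ 1) ∧ ps.length ≤ r ∧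
      (∀ k, k ≤ r → Literature.Probability.Distributions.hypergeomPMFReal (b + d) b r k =
        Literature.Probability.Distributions.PoissonBinomial.pmf ps k) ∧
      ps.sum = (r : ℝ) * b / ((b : ℝ) + d) ∧
      (ps.map fun p => p * (1 - p)).sum =
        (r : ℝ) * b * d * ((b : ℝ) + d - r) / (((b : ℝ) + d) ^ 2 * ((b : ℝ) + d - 1)) := by
  obtain ⟨ps, hps, hlen, hfac⟩ := exists_bernoulliProd_eq_hyperGen hr
  refine ⟨ps, hps, hlen, fun k hk => ?_, sum_eq_of_hyperGen_eq hr hlen hfac,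
    sum_mul_one_sub_eq_of_hyperGen_eq hr hlen hfac⟩
  rw [pmf_eq_of_hyperGen_eq hr hfac, if_pos hk, Literature.Probability.Distributions.hypergeomPMFReal,
    Nat.add_sub_cancel_left, Nat.cast_mul]

/-! ### §5 Binomial moments of all orders and the factorial-moment tail bound

The `k`-th binomial moment of the hypergeometric weights is `Σ_j C(j,k)·C(b,j)·C(d,r−j) = C(b,k)·C(b−k+d, r−k)`
(the first two, `k = 1, 2`, are §4's factorial moments); since `C(j,k) ≥ 1` for `j ≥ k`, Markov's
inequality on the binomial moment bounds the upper tail: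
`Σ_{j ≥ k} C(b,j)·C(d,r−j) ≤ C(b,k)·C(b+d−k, r−k) = C(b+d,r)·C(r,k)·C(b,k)/C(b+d,k) ≤ C(b+d,r)·C(r,k)·(b/(b+d))^k`
— the probability that `k` prescribed draws are all marked, times the number of `k`-sets of draws. -/

/-- `C(k+i, k)·C(b, k+i) = C(b, k)·C(b−k, i)` (choose the `k` marked-and-distinguished items first).
[cite: LehmannRomano2005, Example 3.4.1] -/
theorem choose_add_mul_choose (b k i : ℕ) :
    (k + i).choose k * b.choose (k + i) = b.choose k * (b - k).choose i := by
  have h := Nat.choose_mul (n := b) (k := k + i) (s := k) (Nat.le_add_right k i)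
  rw [Nat.add_sub_cancel_left] at h
  rw [mul_comm, h]

/-- **The `k`-th binomial moment of the hypergeometric weights**: for `k ≤ r`,
`Σ_{j ≤ r} C(j,k)·C(b,j)·C(d,r−j) = C(b,k)·C(b−k+d, r−k)`. [cite: LehmannRomano2005, Example 3.4.1] -/
theorem sum_choose_mul_choose_mul_choose (b d r k : ℕ) (hk : k ≤ r) :
    ∑ j ∈ range (r + 1), j.choose k * (b.choose j * d.choose (r - j)) =
      b.choose k * ((b - k) + d).choose (r - k) := by
  -- the terms `j < k` vanish; reindex `j = k + i`
  have hsplit : ∑ j ∈ range (r + 1), j.choose k * (b.choose j * d.choose (r - j)) =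
      ∑ i ∈ range (r - k + 1), (k + i).choose k * (b.choose (k + i) * d.choose (r - k - i)) := by
    rw [← sum_range_add_sum_Ico _ (show k ≤ r + 1 by omega)]
    rw [sum_eq_zero (fun j hj => by rw [Nat.choose_eq_zero_of_lt (mem_range.1 hj), zero_mul]), zero_add]
    rw [sum_Ico_eq_sum_range, show r + 1 - k = r - k + 1 by omega]
    refine sum_congr rfl fun i _ => ?_
    rw [show r - (k + i) = r - k - i by omega]
  rw [hsplit]
  have hterm : ∀ i ∈ range (r - k + 1),
      (k + i).choose k * (b.choose (k + i) * d.choose (r - k - i)) =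
        b.choose k * ((b - k).choose i * d.choose (r - k - i)) := by
    intro i _
    rw [← mul_assoc, choose_add_mul_choose, mul_assoc]
  rw [sum_congr rfl hterm, ← mul_sum, Nat.add_choose_eq,
    Finset.Nat.sum_antidiagonal_eq_sum_range_succ (fun i j => (b - k).choose i * d.choose j) (r - k)]

/-- **Factorial-moment (Markov) tail bound for the hypergeometric weights**: for `k ≤ r`,
`Σ_{k ≤ j ≤ r} C(b,j)·C(d,r−j) ≤ C(b,k)·C(b−k+d, r−k)`. [cite: LehmannRomano2005, Example 3.4.1] -/
theorem sum_Ico_choose_mul_choose_le (b d r k : ℕ) (hk : k ≤ r) :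
    ∑ j ∈ Ico k (r + 1), b.choose j * d.choose (r - j) ≤ b.choose k * ((b - k) + d).choose (r - k) := by
  rw [← sum_choose_mul_choose_mul_choose b d r k hk, ← sum_range_add_sum_Ico _ (show k ≤ r + 1 by omega)]
  refine le_add_left (sum_le_sum fun j hj => ?_)
  exact Nat.le_mul_of_pos_left _ (Nat.choose_pos (mem_Ico.1 hj).1)

/-- The normalising identity `C(b+d,r)·C(r,k) = C(b+d,k)·C(b+d−k, r−k)` and hence, for `k ≤ b`,
`C(b,k)·C(b−k+d, r−k)·C(b+d,k) = C(b+d,r)·C(r,k)·C(b,k)`. [cite: LehmannRomano2005, Example 3.4.1] -/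
theorem choose_mul_choose_sub_mul (b d r k : ℕ) (hk : k ≤ r) (hkb : k ≤ b) :
    b.choose k * ((b - k) + d).choose (r - k) * (b + d).choose k =
      (b + d).choose r * r.choose k * b.choose k := by
  have h := Nat.choose_mul (n := b + d) (k := r) (s := k) hk
  rw [show b - k + d = b + d - k by omega, h]
  ring

/-- `C(b,k)·(b+d)^k ≤ C(b+d,k)·b^k`: the probability that `k` prescribed draws without replacement are
all marked is at most `(b/(b+d))^k` (`k!·C(n,k) = Π_{i<k}(n−i)` and `(b−i)(b+d) ≤ (b+d−i)·b` termwise).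
[cite: LehmannRomano2005, Example 3.4.1] -/
theorem choose_mul_pow_le_nat (b d k : ℕ) : b.choose k * (b + d) ^ k ≤ (b + d).choose k * b ^ k := by
  have hfac : 0 < k.factorial := Nat.factorial_pos k
  refine Nat.le_of_mul_le_mul_left ?_ hfac
  have e1 : k.factorial * (b.choose k * (b + d) ^ k) = ∏ i ∈ range k, (b - i) * (b + d) := by
    rw [← mul_assoc, ← Nat.descFactorial_eq_factorial_mul_choose, Nat.descFactorial_eq_prod_range,
      prod_mul_distrib, prod_const, card_range]
  have e2 : k.factorial * ((b + d).choose k * b ^ k) = ∏ i ∈ range k, (b + d - i) * b := by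
    rw [← mul_assoc, ← Nat.descFactorial_eq_factorial_mul_choose, Nat.descFactorial_eq_prod_range,
      prod_mul_distrib, prod_const, card_range]
  rw [e1, e2]
  refine prod_le_prod' fun i _ => ?_
  rcases Nat.lt_or_ge b i with hbi | hbi
  · rw [Nat.sub_eq_zero_of_le hbi.le, zero_mul]; exact Nat.zero_le _
  · have h : (b - i) * (b + d) + i * d = (b + d - i) * b := by
      zify [hbi, (show i ≤ b + d by omega)]
      ring
    omega

/-- Real form of `choose_mul_pow_le_nat`. [cite: LehmannRomano2005, Example 3.4.1] -/
theorem choose_mul_pow_le (b d k : ℕ) :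
    (b.choose k : ℝ) * ((b : ℝ) + d) ^ k ≤ ((b + d).choose k : ℝ) * (b : ℝ) ^ k := by
  exact_mod_cast choose_mul_pow_le_nat b d k

/-- **The hypergeometric upper tail, normalised**: for `k ≤ r ≤ b + d`,
`Σ_{k ≤ j ≤ r} C(b,j)C(d,r−j)/C(b+d,r) ≤ C(r,k)·C(b,k)/C(b+d,k) ≤ C(r,k)·(b/(b+d))^k` — the
probability that at least `k` of `r` draws without replacement from `b` marked and `d` unmarked items
are marked (in the tree's table: `Σ_{k ≤ j ≤ r} hypergeomPMFReal (b+d) b r j`).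
[cite: LehmannRomano2005, Example 3.4.1] -/
theorem sum_Ico_hypergeomPMFReal_le (b d r k : ℕ) (hk : k ≤ r) (hr : r ≤ b + d) :
    ∑ j ∈ Ico k (r + 1), Literature.Probability.Distributions.hypergeomPMFReal (b + d) b r j ≤
      (r.choose k : ℝ) * (b.choose k : ℝ) / ((b + d).choose k : ℝ) ∧
    (r.choose k : ℝ) * (b.choose k : ℝ) / ((b + d).choose k : ℝ) ≤
      (r.choose k : ℝ) * ((b : ℝ) / ((b : ℝ) + d)) ^ k := by
  have hCr : (0 : ℝ) < ((b + d).choose r : ℝ) := by exact_mod_cast Nat.choose_pos hr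
  have hCk : (0 : ℝ) < ((b + d).choose k : ℝ) := by exact_mod_cast Nat.choose_pos (hk.trans hr)
  constructor
  · -- the tail sum over the common denominator
    have hsum : ∑ j ∈ Ico k (r + 1), Literature.Probability.Distributions.hypergeomPMFReal (b + d) b r j =
        ((∑ j ∈ Ico k (r + 1), b.choose j * d.choose (r - j) : ℕ) : ℝ) / ((b + d).choose r : ℝ) := by
      rw [Nat.cast_sum, sum_div]
      refine sum_congr rfl fun j _ => ?_
      rw [Literature.Probability.Distributions.hypergeomPMFReal, Nat.add_sub_cancel_left, Nat.cast_mul]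
    rw [hsum, div_le_div_iff₀ hCr hCk]
    rcases Nat.lt_or_ge b k with hbk | hbk
    · -- no `k` marked items at all: the tail is empty
      have h0 : ∑ j ∈ Ico k (r + 1), b.choose j * d.choose (r - j) = 0 :=
        sum_eq_zero fun j hj => by rw [Nat.choose_eq_zero_of_lt (by have := (mem_Ico.1 hj).1; omega), zero_mul]
      rw [h0]; simp; positivity
    · have h1 := sum_Ico_choose_mul_choose_le b d r k hk
      have h2 := choose_mul_choose_sub_mul b d r k hk hbk
      have h1' : ((∑ j ∈ Ico k (r + 1), b.choose j * d.choose (r - j) : ℕ) : ℝ) * ((b + d).choose k : ℝ) ≤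
          ((b.choose k * ((b - k) + d).choose (r - k) * (b + d).choose k : ℕ) : ℝ) := by
        rw [Nat.cast_mul (b.choose k * _)]
        exact mul_le_mul_of_nonneg_right (by exact_mod_cast h1) (by positivity)
      rw [h2] at h1'
      push_cast at h1' ⊢
      linarith
  · rw [mul_div_assoc]
    refine mul_le_mul_of_nonneg_left ?_ (by positivity)
    rcases Nat.eq_zero_or_pos k with rfl | hkpos
    · simp
    · have hbd : (0 : ℝ) < (b : ℝ) + d := by
        have : 0 < b + d := by omega
        exact_mod_cast this
      rw [div_pow, div_le_div_iff₀ hCk (pow_pos hbd k)]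
      have := choose_mul_pow_le b d k
      linarith

end Literature.Combinatorics.StablePolynomials

end
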